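import Literature.NumberTheory.LFunctions.KMVCentralValueSquaredAFESeries
import Mathlib.Analysis.SpecialFunctions.Gaussian.GaussianIntegral
import Mathlib.Analysis.SumIntegralComparisons
import Mathlib.Analysis.PSeries
import Mathlib.NumberTheory.Harmonic.Bounds
import HarnessLib

/-!
# The real cutoff `W(y) = ∫_0^∞ e^{−u−y/u} du` of KMV 2000 (21)–(22): Hölder increments and the
# size of the double sums `Σ_{n₁,n₂} (n₁n₂)^a W(n₁n₂/X)` (the "length `X`" of the approximate
# functional equation)

Topic `Literature/NumberTheory/LFunctions` (namespace `Literature.NumberTheory.LFunctions.KMV2000`, the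
home of `KMV2000.cutoffW`). PROOFS ONLY — no definition, no named fact (D-0026). Cell `landau-siegel`,
unit `littype-ls-input-ismix` (I5, the mixed first moment of [IwaniecSarnak2000] at prime level,
weight 2): STEP 2, the two elementary analytic inputs about the weight `W` that the first-moment
bookkeeping needs.

* `cutoffW_sub_cutoffW_le` — **Hölder-½ increments**: `0 ≤ W(u) − W(v) ≤ 2√(v − u)` for
  `0 ≤ u ≤ v` (pointwise `e^{−u/t} − e^{−v/t} ≤ min(1, (v−u)/t) ≤ √((v−u)/t)` and
  `∫_0^∞ e^{−t} t^{−1/2} dt = Γ(½) = √π ≤ 2`); hence `1 − W(v) ≤ 2√v` (`one_sub_cutoffW_le`).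
  (`W` is smooth on `(0,∞)` with `W′ = −2K₀(2√·)`, logarithmic at `0`; the Hölder form is what the
  Abel summation of the diagonal `Σ χ(n) W(n²/X)/n` against `L(1,χ)` uses, and needs no Bessel
  functions.)
* `cutoffW_le_div_one_add_pow_four` — `W(y) ≤ 1290240/(1+y)⁴` (`y ≥ 0`), a polynomial form of the
  decay «`W(y) ≪ e^{−c√y}`» [KowalskiMichelVanderKam2000, (22)] (tree: `cutoffW_le_two_mul_exp_neg_sqrt`).
* `sum_sum_inv_one_add_sq_le` — `Σ_{n₁,n₂ ≤ M} (1 + n₁n₂/X)^{−2} ≤ 5X(1 + log X)` for `X ≥ 1`,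
  uniformly in `M` (inner sum `≤ min(X/n₁, 2X²/n₁²)` by the integral test and `Σ n^{−2}`-tails;
  harmonic sum `≤ 1 + log`).
* `summable_prod_rpow_mul_cutoffW`, `tsum_prod_rpow_mul_cutoffW_le` — for `0 ≤ a ≤ 2`, `X ≥ 1`:
  `Σ_{n₁,n₂ ≥ 1} (n₁n₂)^a W(n₁n₂/X) ≤ 6451200 · X^{1+a} (1 + log X)` (absolutely convergent over
  `ℕ × ℕ`): the double series opened by the approximate functional equation has "length" `X` in
  `n₁n₂`, up to a logarithm [IwaniecKowalski2004, §5.2 (after (5.14)): the sums are effectively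
  limited to `n₁n₂ ≪ X^{1+ε}`].

Constants are explicit and crude; nothing here is specific to modular forms.

## References

* [KowalskiMichelVanderKam2000] E. Kowalski, P. Michel, J. VanderKam, J. reine angew. Math. 526
  (2000), §5 (21)–(22) p. 12 (held `paper:doi-10-1515-crll-2000-074`).
* [IwaniecKowalski2004] H. Iwaniec, E. Kowalski, *Analytic Number Theory*, §5.2 (Thm. 5.3, (5.14)).
-/

noncomputable section

open scoped Real
open Set MeasureTheory Filter Finset

namespace Literature.NumberTheory.LFunctions.KMV2000

/-! ### Hölder-½ increments of `W` -/

/-- For `0 ≤ a ≤ b`: `e^{−a} − e^{−b} ≤ √(b − a)` (it is `≤ 1` and `≤ b − a`, and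
`min(1, x) ≤ √x`). [cite: KowalskiMichelVanderKam2000, §5 (22) p. 12] -/
theorem exp_neg_sub_exp_neg_le_sqrt {a b : ℝ} (ha : 0 ≤ a) (hab : a ≤ b) :
    Real.exp (-a) - Real.exp (-b) ≤ Real.sqrt (b - a) := by
  have hd : 0 ≤ b - a := sub_nonneg.mpr hab
  have hea : Real.exp (-a) ≤ 1 := Real.exp_le_one_iff.mpr (neg_nonpos.mpr ha)
  have h1 : Real.exp (-a) - Real.exp (-b) ≤ 1 := by
    have := (Real.exp_pos (-b)).le
    linarith
  have h2 : Real.exp (-a) - Real.exp (-b) ≤ b - a := by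
    have hx : 1 - (b - a) ≤ Real.exp (-(b - a)) := by
      have := Real.add_one_le_exp (-(b - a)); linarith
    have heb : Real.exp (-b) = Real.exp (-a) * Real.exp (-(b - a)) := by
      rw [← Real.exp_add]; ring_nf
    have h3 : Real.exp (-a) * (1 - (b - a)) ≤ Real.exp (-a) * Real.exp (-(b - a)) :=
      mul_le_mul_of_nonneg_left hx (Real.exp_pos _).le
    have h4 : Real.exp (-a) * (b - a) ≤ 1 * (b - a) := mul_le_mul_of_nonneg_right hea hd
    rw [heb]
    nlinarith [h3, h4]
  by_cases hle : b - a ≤ 1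
  · calc Real.exp (-a) - Real.exp (-b) ≤ b - a := h2
      _ = Real.sqrt ((b - a) ^ 2) := (Real.sqrt_sq hd).symm
      _ ≤ Real.sqrt (b - a) := Real.sqrt_le_sqrt (by nlinarith [hd, hle])
  · have hlt : 1 < b - a := not_le.mp hle
    calc Real.exp (-a) - Real.exp (-b) ≤ 1 := h1
      _ ≤ Real.sqrt (b - a) := Real.one_le_sqrt.mpr hlt.le

/-- `√π ≤ 2`. [folklore] -/
private theorem sqrt_pi_le_two : Real.sqrt π ≤ 2 := by
  rw [show (2 : ℝ) = Real.sqrt 4 by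
    rw [show (4 : ℝ) = 2 ^ 2 by norm_num, Real.sqrt_sq (by norm_num)]]
  exact Real.sqrt_le_sqrt Real.pi_le_four

/-- **Hölder-½ increments of `W`**: for `0 ≤ u ≤ v`, `W(u) − W(v) ≤ 2 √(v − u)`
(`W(u) − W(v) = ∫_0^∞ e^{−t}(e^{−u/t} − e^{−v/t}) dt ≤ √(v−u) ∫_0^∞ e^{−t} t^{−1/2} dt = √(π(v−u))`).
[cite: KowalskiMichelVanderKam2000, §5 (22) p. 12] -/
theorem cutoffW_sub_cutoffW_le {u v : ℝ} (hu : 0 ≤ u) (huv : u ≤ v) :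
    cutoffW u - cutoffW v ≤ 2 * Real.sqrt (v - u) := by
  have hv : 0 ≤ v := hu.trans huv
  have hG : IntegrableOn (fun t : ℝ ↦ Real.exp (-t) * t ^ ((1 : ℝ) / 2 - 1)) (Ioi 0) :=
    Real.GammaIntegral_convergent (by norm_num)
  rw [cutoffW, cutoffW,
    ← integral_sub (integrableOn_exp_neg_sub_div hu) (integrableOn_exp_neg_sub_div hv)]
  have hle : ∫ t in Ioi (0 : ℝ), (Real.exp (-t - u / t) - Real.exp (-t - v / t)) ≤
      ∫ t in Ioi (0 : ℝ), Real.sqrt (v - u) * (Real.exp (-t) * t ^ ((1 : ℝ) / 2 - 1)) := by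
    refine setIntegral_mono_on
      ((integrableOn_exp_neg_sub_div hu).sub (integrableOn_exp_neg_sub_div hv)) (hG.const_mul _)
      measurableSet_Ioi fun t ht ↦ ?_
    have ht0 : (0 : ℝ) < t := ht
    have h1 : Real.exp (-t - u / t) - Real.exp (-t - v / t) =
        Real.exp (-t) * (Real.exp (-(u / t)) - Real.exp (-(v / t))) := by
      rw [mul_sub, ← Real.exp_add, ← Real.exp_add]; ring_nf
    have h2 : Real.exp (-(u / t)) - Real.exp (-(v / t)) ≤ Real.sqrt (v / t - u / t) :=
      exp_neg_sub_exp_neg_le_sqrt (div_nonneg hu ht0.le) (div_le_div_of_nonneg_right huv ht0.le)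
    have h3 : Real.sqrt (v / t - u / t) = Real.sqrt (v - u) * t ^ ((1 : ℝ) / 2 - 1) := by
      rw [← sub_div, Real.sqrt_div' _ ht0.le, Real.sqrt_eq_rpow t, div_eq_mul_inv,
        ← Real.rpow_neg ht0.le]
      norm_num
    rw [h1]
    calc Real.exp (-t) * (Real.exp (-(u / t)) - Real.exp (-(v / t)))
        ≤ Real.exp (-t) * Real.sqrt (v / t - u / t) :=
          mul_le_mul_of_nonneg_left h2 (Real.exp_pos _).le
      _ = Real.sqrt (v - u) * (Real.exp (-t) * t ^ ((1 : ℝ) / 2 - 1)) := by rw [h3]; ring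
  calc ∫ t in Ioi (0 : ℝ), (Real.exp (-t - u / t) - Real.exp (-t - v / t))
      ≤ ∫ t in Ioi (0 : ℝ), Real.sqrt (v - u) * (Real.exp (-t) * t ^ ((1 : ℝ) / 2 - 1)) := hle
    _ = Real.sqrt (v - u) * Real.Gamma (1 / 2) := by
        rw [integral_const_mul, Real.Gamma_eq_integral (by norm_num : (0 : ℝ) < 1 / 2)]
    _ ≤ 2 * Real.sqrt (v - u) := by
        rw [Real.Gamma_one_half_eq, mul_comm]
        exact mul_le_mul_of_nonneg_right sqrt_pi_le_two (Real.sqrt_nonneg _)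

/-- `1 − W(v) ≤ 2√v` for `v ≥ 0` (`W(0) = 1`). [cite: KowalskiMichelVanderKam2000, §5 (22) p. 12] -/
theorem one_sub_cutoffW_le {v : ℝ} (hv : 0 ≤ v) : 1 - cutoffW v ≤ 2 * Real.sqrt v := by
  have h := cutoffW_sub_cutoffW_le le_rfl hv
  rwa [cutoffW_zero, sub_zero] at h

/-- `|W(u) − W(v)| ≤ 2√|u − v|` for `u, v ≥ 0`. [cite: KowalskiMichelVanderKam2000, §5 (22) p. 12] -/
theorem abs_cutoffW_sub_cutoffW_le {u v : ℝ} (hu : 0 ≤ u) (hv : 0 ≤ v) :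
    |cutoffW u - cutoffW v| ≤ 2 * Real.sqrt |u - v| := by
  rcases le_total u v with huv | hvu
  · have hnn : 0 ≤ cutoffW u - cutoffW v :=
      sub_nonneg.mpr (cutoffW_antitoneOn hu hv huv)
    rw [abs_of_nonneg hnn, abs_sub_comm, abs_of_nonneg (sub_nonneg.mpr huv)]
    exact cutoffW_sub_cutoffW_le hu huv
  · have hnn : 0 ≤ cutoffW v - cutoffW u :=
      sub_nonneg.mpr (cutoffW_antitoneOn hv hu hvu)
    rw [abs_sub_comm, abs_of_nonneg hnn, abs_of_nonneg (sub_nonneg.mpr hvu)]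
    exact cutoffW_sub_cutoffW_le hv hvu

/-! ### Polynomial decay `W(y) ≤ c (1+y)^{−4}` and the weight `(n₁n₂)^a W(n₁n₂/X)` -/

/-- `W(y) ≤ 1290240 / (1 + y)⁴` for `y ≥ 0` (from `W ≤ 1`, `W(y) ≤ 2e^{−√y}` and `e^{−x} ≤ 8!/x⁸`).
[cite: KowalskiMichelVanderKam2000, §5 (22) p. 12] -/
theorem cutoffW_le_div_one_add_pow_four {y : ℝ} (hy : 0 ≤ y) :
    cutoffW y ≤ 1290240 / (1 + y) ^ 4 := by
  have h1y : 0 < 1 + y := by linarith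
  rcases le_or_gt y 1 with hy1 | hy1
  · -- `W ≤ 1 ≤ 1290240/16 ≤ 1290240/(1+y)⁴`
    have hpow : (1 + y) ^ 4 ≤ 16 := by
      have h2 : 1 + y ≤ 2 := by linarith
      calc (1 + y) ^ 4 ≤ (2 : ℝ) ^ 4 := by gcongr
        _ = 16 := by norm_num
    calc cutoffW y ≤ 1 := cutoffW_le_one hy
      _ ≤ 1290240 / 16 := by norm_num
      _ ≤ 1290240 / (1 + y) ^ 4 := by
          apply div_le_div_of_nonneg_left (by norm_num) (by positivity) hpow
  · have hy0 : 0 < y := by linarith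
    have hs : 0 < Real.sqrt y := Real.sqrt_pos.mpr hy0
    have h2 : Real.sqrt y ^ 8 / 40320 ≤ Real.exp (Real.sqrt y) := by
      have := Real.pow_div_factorial_le_exp (x := Real.sqrt y) hs.le 8
      norm_num [Nat.factorial] at this
      exact this
    have h4 : Real.sqrt y ^ 8 = y ^ 4 := by
      rw [show (8 : ℕ) = 2 * 4 from rfl, pow_mul, Real.sq_sqrt hy]
    rw [h4] at h2
    have h3 : Real.exp (-Real.sqrt y) ≤ 40320 / y ^ 4 := by
      rw [Real.exp_neg, inv_eq_one_div, div_le_div_iff₀ (Real.exp_pos _) (by positivity)]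
      linarith
    have hpow : (1 + y) ^ 4 ≤ 16 * y ^ 4 := by
      have : 1 + y ≤ 2 * y := by linarith
      calc (1 + y) ^ 4 ≤ (2 * y) ^ 4 := by gcongr
        _ = 16 * y ^ 4 := by ring
    calc cutoffW y ≤ 2 * Real.exp (-Real.sqrt y) := cutoffW_le_two_mul_exp_neg_sqrt hy
      _ ≤ 2 * (40320 / y ^ 4) := by gcongr
      _ = 1290240 / (16 * y ^ 4) := by field_simp; norm_num
      _ ≤ 1290240 / (1 + y) ^ 4 :=
          div_le_div_of_nonneg_left (by norm_num) (by positivity) hpow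

/-- **The weight of the double series**: for `0 ≤ a ≤ 2`, `X > 0`, `m ≥ 0`,
`m^a W(m/X) ≤ 1290240 · X^a · (1 + m/X)^{−2}` (`m^a = X^a (m/X)^a ≤ X^a (1+m/X)^a` and
`(1+y)^{a−4} ≤ (1+y)^{−2}`). [cite: KowalskiMichelVanderKam2000, §5 (22) p. 12] -/
theorem rpow_mul_cutoffW_le {a m X : ℝ} (ha0 : 0 ≤ a) (ha2 : a ≤ 2) (hX : 0 < X) (hm : 0 ≤ m) :
    m ^ a * cutoffW (m / X) ≤ 1290240 * X ^ a * ((1 + m / X) ^ 2)⁻¹ := by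
  set y : ℝ := m / X with hy_def
  have hy : 0 ≤ y := div_nonneg hm hX.le
  have h1y : 1 ≤ 1 + y := by linarith
  have hmy : m = X * y := by rw [hy_def]; field_simp
  have hma : m ^ a = X ^ a * y ^ a := by rw [hmy, Real.mul_rpow hX.le hy]
  have hya : y ^ a ≤ (1 + y) ^ a := Real.rpow_le_rpow hy (by linarith) ha0
  have hW := cutoffW_le_div_one_add_pow_four hy
  have hexp : (1 + y) ^ a / (1 + y) ^ 4 ≤ ((1 + y) ^ 2)⁻¹ := by
    rw [div_eq_mul_inv, ← Real.rpow_natCast _ 4, ← Real.rpow_neg (by linarith),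
      ← Real.rpow_add (by linarith), ← Real.rpow_natCast _ 2, ← Real.rpow_neg (by linarith)]
    exact Real.rpow_le_rpow_of_exponent_le h1y (by push_cast; linarith)
  calc m ^ a * cutoffW (m / X) = X ^ a * (y ^ a * cutoffW y) := by rw [hma, mul_assoc]
    _ ≤ X ^ a * ((1 + y) ^ a * (1290240 / (1 + y) ^ 4)) :=
        mul_le_mul_of_nonneg_left
          (mul_le_mul hya hW (cutoffW_nonneg _) (Real.rpow_nonneg (by linarith) _))
          (Real.rpow_nonneg hX.le _)
    _ = 1290240 * X ^ a * ((1 + y) ^ a / (1 + y) ^ 4) := by ring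
    _ ≤ 1290240 * X ^ a * ((1 + y) ^ 2)⁻¹ := by gcongr

/-! ### The double sum `Σ_{n₁,n₂} (1 + n₁n₂/X)^{−2}` -/

/-- Inner sum, integral test: for `r, X > 0`,
`Σ_{j=1}^{M} (1 + r j/X)^{−2} ≤ ∫_0^M (1 + rt/X)^{−2} dt ≤ X/r`.
[cite: IwaniecKowalski2004, §5.2 (after (5.14))] -/
theorem sum_range_inv_one_add_sq_le_div {r X : ℝ} (hr : 0 < r) (hX : 0 < X) (M : ℕ) :
    ∑ j ∈ Finset.range M, ((1 + r * ((j + 1 : ℕ) : ℝ) / X) ^ 2)⁻¹ ≤ X / r := by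
  set f : ℝ → ℝ := fun t ↦ ((1 + r * t / X) ^ 2)⁻¹ with hf
  have hpos : ∀ t : ℝ, 0 ≤ t → 0 < 1 + r * t / X := fun t ht ↦ by positivity
  -- antitone on `[0, M]`
  have hanti : AntitoneOn f (Icc (0 : ℝ) M) := by
    intro s hs t _ hst
    simp only [hf]
    have hs0 := hpos s hs.1
    apply inv_anti₀ (pow_pos hs0 2)
    gcongr
  have hsum := AntitoneOn.sum_le_integral_Ico (Nat.zero_le M) (by simpa using hanti)
  simp only [Nat.Ico_zero_eq_range, Nat.cast_zero] at hsum
  -- the integral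
  set F : ℝ → ℝ := fun t ↦ -(X / r) * (1 + r * t / X)⁻¹ with hF
  have hderiv : ∀ t ∈ uIcc (0 : ℝ) M, HasDerivAt F (f t) t := by
    intro t ht
    rw [Set.uIcc_of_le (Nat.cast_nonneg M)] at ht
    have ht0 := hpos t ht.1
    have hc : HasDerivAt (fun t : ℝ ↦ 1 + r * t / X) (r / X) t := by
      have h := (((hasDerivAt_id t).const_mul r).div_const X).const_add 1
      simp only [id, mul_one] at h
      exact h
    have hinv := (hc.inv ht0.ne').const_mul (-(X / r))
    refine hinv.congr_deriv ?_
    simp only [hf]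
    field_simp
  have hcont : ContinuousOn f (uIcc (0 : ℝ) M) := by
    rw [Set.uIcc_of_le (Nat.cast_nonneg M)]
    refine ContinuousOn.inv₀ (by fun_prop) fun t ht ↦ ?_
    exact (pow_pos (hpos t ht.1) 2).ne'
  have hint : ∫ t in (0 : ℝ)..M, f t = F M - F 0 :=
    intervalIntegral.integral_eq_sub_of_hasDerivAt hderiv (hcont.intervalIntegrable)
  have hFM : F M - F 0 ≤ X / r := by
    simp only [hF, mul_zero, zero_div, add_zero, inv_one, mul_one]
    have hM0 := hpos M (Nat.cast_nonneg M)
    have : 0 ≤ X / r * (1 + r * M / X)⁻¹ := by positivity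
    linarith
  calc ∑ j ∈ Finset.range M, ((1 + r * ((j + 1 : ℕ) : ℝ) / X) ^ 2)⁻¹
      = ∑ j ∈ Finset.range M, f ((j + 1 : ℕ) : ℝ) := by simp only [hf]
    _ ≤ ∫ t in (0 : ℝ)..M, f t := hsum
    _ ≤ X / r := by rw [hint]; exact hFM

/-- Inner sum, tail form: for `r, X > 0`, `Σ_{j=1}^{M} (1 + rj/X)^{−2} ≤ 2 X²/r²`
(`(1 + rj/X)^{−2} ≤ (X/r)² j^{−2}` and `Σ j^{−2} ≤ 2`). [cite: IwaniecKowalski2004, §5.2 (after (5.14))] -/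
theorem sum_range_inv_one_add_sq_le_sq {r X : ℝ} (hr : 0 < r) (hX : 0 < X) (M : ℕ) :
    ∑ j ∈ Finset.range M, ((1 + r * ((j + 1 : ℕ) : ℝ) / X) ^ 2)⁻¹ ≤ 2 * (X / r) ^ 2 := by
  have hterm : ∀ j ∈ Finset.range M, ((1 + r * ((j + 1 : ℕ) : ℝ) / X) ^ 2)⁻¹ ≤
      (X / r) ^ 2 * ((((j + 1 : ℕ) : ℝ)) ^ 2)⁻¹ := by
    intro j _
    have hj : (0 : ℝ) < ((j + 1 : ℕ) : ℝ) := by positivity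
    have hlow : r * ((j + 1 : ℕ) : ℝ) / X ≤ 1 + r * ((j + 1 : ℕ) : ℝ) / X := by linarith
    have hpos : 0 < r * ((j + 1 : ℕ) : ℝ) / X := by positivity
    calc ((1 + r * ((j + 1 : ℕ) : ℝ) / X) ^ 2)⁻¹ ≤ ((r * ((j + 1 : ℕ) : ℝ) / X) ^ 2)⁻¹ := by
          apply inv_anti₀ (pow_pos hpos 2)
          gcongr
      _ = (X / r) ^ 2 * ((((j + 1 : ℕ) : ℝ)) ^ 2)⁻¹ := by
          field_simp
  have htail : ∑ j ∈ Finset.range M, ((((j + 1 : ℕ) : ℝ)) ^ 2)⁻¹ ≤ 2 := by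
    have h := sum_Ioo_inv_sq_le (α := ℝ) 0 (M + 1)
    have hre : ∑ j ∈ Finset.range M, ((((j + 1 : ℕ) : ℝ)) ^ 2)⁻¹ =
        ∑ i ∈ Finset.Ioo 0 (M + 1), ((i : ℝ) ^ 2)⁻¹ := by
      refine Finset.sum_nbij' (fun j ↦ j + 1) (fun i ↦ i - 1) ?_ ?_ ?_ ?_ ?_
      · intro j hj; simp only [Finset.mem_range] at hj; simp only [Finset.mem_Ioo]; omega
      · intro i hi; simp only [Finset.mem_Ioo] at hi; simp only [Finset.mem_range]; omega
      · intro j _; simp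
      · intro i hi; simp only [Finset.mem_Ioo] at hi; omega
      · intro j _; push_cast; ring
    rw [hre]
    calc ∑ i ∈ Finset.Ioo 0 (M + 1), ((i : ℝ) ^ 2)⁻¹ ≤ 2 / (0 + 1) := by exact_mod_cast h
      _ = 2 := by norm_num
  calc ∑ j ∈ Finset.range M, ((1 + r * ((j + 1 : ℕ) : ℝ) / X) ^ 2)⁻¹
      ≤ ∑ j ∈ Finset.range M, (X / r) ^ 2 * ((((j + 1 : ℕ) : ℝ)) ^ 2)⁻¹ := Finset.sum_le_sum hterm
    _ = (X / r) ^ 2 * ∑ j ∈ Finset.range M, ((((j + 1 : ℕ) : ℝ)) ^ 2)⁻¹ := by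
        rw [Finset.mul_sum]
    _ ≤ (X / r) ^ 2 * 2 := by gcongr
    _ = 2 * (X / r) ^ 2 := by ring

/-- **The double sum**: for `X ≥ 1` and every `M`,
`Σ_{n₁=1}^{M} Σ_{n₂=1}^{M} (1 + n₁n₂/X)^{−2} ≤ 5 X (1 + log X)` (rows `n₁ ≤ X` contribute `≤ X/n₁`,
rows `n₁ > X` contribute `≤ 2X²/n₁²`). [cite: IwaniecKowalski2004, §5.2 (after (5.14))] -/
theorem sum_sum_inv_one_add_sq_le {X : ℝ} (hX : 1 ≤ X) (M : ℕ) :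
    ∑ i ∈ Finset.range M, ∑ j ∈ Finset.range M,
        ((1 + ((i + 1 : ℕ) : ℝ) * ((j + 1 : ℕ) : ℝ) / X) ^ 2)⁻¹ ≤ 5 * X * (1 + Real.log X) := by
  have hX0 : 0 < X := by linarith
  have hlog : 0 ≤ Real.log X := Real.log_nonneg hX
  set K : ℕ := ⌊X⌋₊ with hK
  have hK1 : 1 ≤ K := by rw [hK]; exact Nat.one_le_floor_iff _ |>.mpr hX
  have hKX : (K : ℝ) ≤ X := Nat.floor_le hX0.le
  have hXK : X < (K : ℝ) + 1 := Nat.lt_floor_add_one X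
  -- row bounds
  have hrow1 : ∀ i : ℕ, ∑ j ∈ Finset.range M,
      ((1 + ((i + 1 : ℕ) : ℝ) * ((j + 1 : ℕ) : ℝ) / X) ^ 2)⁻¹ ≤ X / ((i + 1 : ℕ) : ℝ) :=
    fun i ↦ sum_range_inv_one_add_sq_le_div (by positivity) hX0 M
  have hrow2 : ∀ i : ℕ, ∑ j ∈ Finset.range M,
      ((1 + ((i + 1 : ℕ) : ℝ) * ((j + 1 : ℕ) : ℝ) / X) ^ 2)⁻¹ ≤ 2 * (X / ((i + 1 : ℕ) : ℝ)) ^ 2 :=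
    fun i ↦ sum_range_inv_one_add_sq_le_sq (by positivity) hX0 M
  -- split the rows at `K`
  rw [← Finset.sum_filter_add_sum_filter_not (Finset.range M) (fun i ↦ i < K)]
  have hpart1 : ∑ i ∈ (Finset.range M).filter (fun i ↦ i < K), ∑ j ∈ Finset.range M,
      ((1 + ((i + 1 : ℕ) : ℝ) * ((j + 1 : ℕ) : ℝ) / X) ^ 2)⁻¹ ≤ X * (1 + Real.log X) := by
    calc ∑ i ∈ (Finset.range M).filter (fun i ↦ i < K), ∑ j ∈ Finset.range M,
          ((1 + ((i + 1 : ℕ) : ℝ) * ((j + 1 : ℕ) : ℝ) / X) ^ 2)⁻¹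
        ≤ ∑ i ∈ (Finset.range M).filter (fun i ↦ i < K), X / ((i + 1 : ℕ) : ℝ) :=
          Finset.sum_le_sum fun i _ ↦ hrow1 i
      _ ≤ ∑ i ∈ Finset.range K, X / ((i + 1 : ℕ) : ℝ) := by
          apply Finset.sum_le_sum_of_subset_of_nonneg
          · intro i hi
            simp only [Finset.mem_filter, Finset.mem_range] at hi ⊢
            exact hi.2
          · intro i _ _; positivity
      _ = X * (harmonic K : ℝ) := by
          rw [harmonic]
          push_cast
          rw [Finset.mul_sum]
          refine Finset.sum_congr rfl fun i _ ↦ ?_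
          rw [div_eq_mul_inv]
      _ ≤ X * (1 + Real.log K) := mul_le_mul_of_nonneg_left (harmonic_le_one_add_log K) hX0.le
      _ ≤ X * (1 + Real.log X) := by
          have hK0 : (0 : ℝ) < K := by exact_mod_cast hK1
          gcongr
  have hpart2 : ∑ i ∈ (Finset.range M).filter (fun i ↦ ¬ i < K), ∑ j ∈ Finset.range M,
      ((1 + ((i + 1 : ℕ) : ℝ) * ((j + 1 : ℕ) : ℝ) / X) ^ 2)⁻¹ ≤ 4 * X := by
    have hset : (Finset.range M).filter (fun i ↦ ¬ i < K) = Finset.Ico K M := by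
      ext i
      simp only [Finset.mem_filter, Finset.mem_range, Finset.mem_Ico, not_lt]
      tauto
    rw [hset]
    calc ∑ i ∈ Finset.Ico K M, ∑ j ∈ Finset.range M,
          ((1 + ((i + 1 : ℕ) : ℝ) * ((j + 1 : ℕ) : ℝ) / X) ^ 2)⁻¹
        ≤ ∑ i ∈ Finset.Ico K M, 2 * (X / ((i + 1 : ℕ) : ℝ)) ^ 2 :=
          Finset.sum_le_sum fun i _ ↦ hrow2 i
      _ = 2 * X ^ 2 * ∑ i ∈ Finset.Ico K M, ((((i + 1 : ℕ) : ℝ)) ^ 2)⁻¹ := by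
          rw [Finset.mul_sum]
          refine Finset.sum_congr rfl fun i _ ↦ ?_
          have : (0 : ℝ) < ((i + 1 : ℕ) : ℝ) := by positivity
          field_simp
      _ = 2 * X ^ 2 * ∑ x ∈ Finset.Ioo K (M + 1), ((x : ℝ) ^ 2)⁻¹ := by
          congr 1
          refine Finset.sum_nbij' (fun i ↦ i + 1) (fun x ↦ x - 1) ?_ ?_ ?_ ?_ ?_
          · intro i hi; simp only [Finset.mem_Ico] at hi; simp only [Finset.mem_Ioo]; omega
          · intro x hx; simp only [Finset.mem_Ioo] at hx; simp only [Finset.mem_Ico]; omega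
          · intro i _; simp
          · intro x hx; simp only [Finset.mem_Ioo] at hx; omega
          · intro i _; push_cast; ring
      _ ≤ 2 * X ^ 2 * (2 / ((K : ℝ) + 1)) := by
          gcongr
          exact_mod_cast sum_Ioo_inv_sq_le (α := ℝ) K (M + 1)
      _ ≤ 2 * X ^ 2 * (2 / X) := by
          gcongr
      _ = 4 * X := by field_simp; ring
  calc _ ≤ X * (1 + Real.log X) + 4 * X := add_le_add hpart1 hpart2
    _ ≤ 5 * X * (1 + Real.log X) := by nlinarith

/-! ### The series over `ℕ × ℕ` -/

/-- **Length of the approximate functional equation**: for `0 ≤ a ≤ 2` and `X ≥ 1` the double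
series `Σ_{n₁,n₂ ≥ 1} (n₁n₂)^a W(n₁n₂/X)` converges and is `≤ 6451200 · X^{1+a} (1 + log X)`
(terms with `n₁ = 0` or `n₂ = 0` set to `0`). [cite: IwaniecKowalski2004, §5.2 (after (5.14))]
[cite: KowalskiMichelVanderKam2000, §5 (22) p. 12] -/
theorem summable_prod_rpow_mul_cutoffW {a X : ℝ} (ha0 : 0 ≤ a) (ha2 : a ≤ 2) (hX : 1 ≤ X) :
    Summable (fun p : ℕ × ℕ ↦ if p.1 = 0 ∨ p.2 = 0 then (0 : ℝ)
      else (((p.1 : ℝ) * p.2) ^ a * cutoffW ((p.1 : ℝ) * p.2 / X))) ∧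
    ∑' p : ℕ × ℕ, (if p.1 = 0 ∨ p.2 = 0 then (0 : ℝ)
      else (((p.1 : ℝ) * p.2) ^ a * cutoffW ((p.1 : ℝ) * p.2 / X))) ≤
        6451200 * X ^ (1 + a) * (1 + Real.log X) := by
  have hX0 : 0 < X := by linarith
  set F : ℕ × ℕ → ℝ := fun p ↦ if p.1 = 0 ∨ p.2 = 0 then (0 : ℝ)
      else (((p.1 : ℝ) * p.2) ^ a * cutoffW ((p.1 : ℝ) * p.2 / X)) with hF
  have hF0 : 0 ≤ F := by
    intro p
    simp only [hF, Pi.zero_apply]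
    split_ifs
    · exact le_rfl
    · exact mul_nonneg (Real.rpow_nonneg (by positivity) _) (cutoffW_nonneg _)
  have hFst : ∀ j, F (0, j) = 0 := fun j ↦ by simp [hF]
  have hSnd : ∀ i, F (i, 0) = 0 := fun i ↦ by simp [hF]
  have hsucc : ∀ i j : ℕ, F (i + 1, j + 1) ≤
      1290240 * X ^ a * ((1 + ((i + 1 : ℕ) : ℝ) * ((j + 1 : ℕ) : ℝ) / X) ^ 2)⁻¹ := by
    intro i j
    have hne : ¬ ((i + 1 : ℕ) = 0 ∨ (j + 1 : ℕ) = 0) := by omega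
    simp only [hF, hne, if_false]
    exact rpow_mul_cutoffW_le ha0 ha2 hX0 (by positivity)
  -- uniform bound on finite partial sums
  have hbound : ∀ s : Finset (ℕ × ℕ), ∑ p ∈ s, F p ≤ 6451200 * X ^ (1 + a) * (1 + Real.log X) := by
    intro s
    set M : ℕ := s.sup (fun p ↦ max p.1 p.2) with hM
    have hsub : s ⊆ Finset.range (M + 1) ×ˢ Finset.range (M + 1) := by
      intro p hp
      have h := Finset.le_sup (f := fun p : ℕ × ℕ ↦ max p.1 p.2) hp
      simp only [Finset.mem_product, Finset.mem_range]
      rw [← hM] at h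
      omega
    calc ∑ p ∈ s, F p ≤ ∑ p ∈ Finset.range (M + 1) ×ˢ Finset.range (M + 1), F p :=
          Finset.sum_le_sum_of_subset_of_nonneg hsub fun p _ _ ↦ hF0 p
      _ = ∑ i ∈ Finset.range (M + 1), ∑ j ∈ Finset.range (M + 1), F (i, j) := Finset.sum_product _ _ _
      _ = ∑ i ∈ Finset.range M, ∑ j ∈ Finset.range M, F (i + 1, j + 1) := by
          rw [Finset.sum_range_succ']
          simp only [hFst, Finset.sum_const_zero, add_zero]
          refine Finset.sum_congr rfl fun i _ ↦ ?_
          rw [Finset.sum_range_succ', hSnd, add_zero]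
      _ ≤ ∑ i ∈ Finset.range M, ∑ j ∈ Finset.range M,
            1290240 * X ^ a * ((1 + ((i + 1 : ℕ) : ℝ) * ((j + 1 : ℕ) : ℝ) / X) ^ 2)⁻¹ :=
          Finset.sum_le_sum fun i _ ↦ Finset.sum_le_sum fun j _ ↦ hsucc i j
      _ = 1290240 * X ^ a * ∑ i ∈ Finset.range M, ∑ j ∈ Finset.range M,
            ((1 + ((i + 1 : ℕ) : ℝ) * ((j + 1 : ℕ) : ℝ) / X) ^ 2)⁻¹ := by
          simp only [Finset.mul_sum]
      _ ≤ 1290240 * X ^ a * (5 * X * (1 + Real.log X)) := by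
          gcongr
          exact sum_sum_inv_one_add_sq_le hX M
      _ = 6451200 * X ^ (1 + a) * (1 + Real.log X) := by
          rw [Real.rpow_add hX0, Real.rpow_one]; ring
  exact ⟨summable_of_sum_le hF0 hbound, Real.tsum_le_of_sum_le hF0 hbound⟩

end Literature.NumberTheory.LFunctions.KMV2000

end
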